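import Summits.SmoothPoincare4.SmoothPoincare4.Theorems.ConvexBisectionAcyclicBisectionExistsDualHandlePlumbing
import Summits.SmoothPoincare4.SmoothPoincare4.Theorems.ConvexBisectionAcyclicBisectionExistsBeltPageClause
import HarnessLib

/-!
# Binding points of the prefix seam are unsurgered on the dual side (T3 clause (iii), BIND)
(helper for stub `stub_T3_dualPresentation` = T3, extras ▸ clause (iii); line `modp-braid-orbits`
r12, crux `ConvexBisection.AcyclicBisectionExists`, item stmt-SmoothPoincare4-10508; wave 5 / worker
X6, lead c5; Y7-REPORT §2 row (iii); hypothesis `Hbind` of X2's `T3_of_pieces`, text of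
`work/stubs/X2_interfaces.lean` VERSION 1, `HbindStatement`, verbatim.)

T3 clause (iii): every `X₁`-unsurgered seam point `y` over a BINDING point `a` of the cap
(`w a = 0`) is `W₂`-unsurgered, `b₂.incl (φ y) = D₂.jA a'`.  The assembler (X2) supplies the SEAM
CLAUSE `hseam`: over an old-seam base point `a` whose preimages in the suffix tubes are SHALLOW
(`‖t_λ‖² ≤ 1 − 3κ²/4`, the zone not moved by the push of the prefix piece) the new seam is the dual
embedding of the old one.  So the content of (iii) is:

* §1 `exists_binding_shallow` — **binding points have shallow tube preimages**: for a Lefschetz link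
  `h` there is `κ₀ > 0` (depending on `g, l, h` only) such that every tube point `t` of every handle
  with `w (h̄ᵢ t) = 0` has `‖t_λ‖² ≤ 1 − 3κ₀²/4`.  Indeed `w = pageDir/2` (modulus `1/2`) on the
  attaching circle (`IsLefschetzLink.mem_page`), so by uniform continuity at the circle
  (`BeltPageClause.exists_lamSq_gt`, p137382) `‖w (h̄ᵢ t) − pageDir/2‖ < 1/4`, hence `w ≠ 0`, on
  `{‖t_λ‖² > 1 − δᵢ}`; take `3κ₀²/4 ≤ minᵢ δᵢ`.  Registered sub-goal: `helper_binding_shallow`;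
* §2 `T3_bind` — clause (iii) from `hseam` for `κ ≤ κ₀`: a binding point is off ALL attaching
  circles (they lie in pages, `w ≠ 0`), so `a` lifts to `M ∖ ⋃ cores`; it is a boundary point of the
  cap (`D₁.jA a ∈ ∂X₁`, open smooth embeddings and open submanifolds preserve boundary points), so
  `D.jA a = bX.incl z`; its suffix-tube preimages are shallow by §1; `hseam` gives
  `a' := ⟨(bBase g).incl (Ψ z), incl_mem_coresComplement_dualMap …⟩`.

Everything is proved; no definitions, no named facts, no `sorry`.  References: A. A. Kosinski,
*Differential Manifolds* (1993), VI §6 [Kosinski1993]; R. E. Gompf, A. I. Stipsicz, *4-Manifolds and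
Kirby Calculus* (1999), §8.2 [GompfStipsicz1999].
-/

noncomputable section

-- the prescribed namespace `Summit.<P>.<Sub>.…` duplicates `SmoothPoincare4` (P = Sub)
set_option linter.dupNamespace false

open scoped Manifold ContDiff Topology
open Set Function Metric
open Literature.Topology.FourManifolds Literature.Topology.FourManifolds.HandleAttachingMap
  Literature.Topology.FourManifolds.LefschetzBase

namespace Summit.SmoothPoincare4.SmoothPoincare4.Theorems.AcyclicBisectionExists.ModpBraidOrbits

namespace DualBind

/-! ## §1 Binding points have shallow tube preimages -/

/-- **On the attaching circle of a handle of a Lefschetz link, `w = pageDir/2`.** [folklore] -/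
theorem w_toFun_coreTubePt {g : ℕ} {l : List ((Fin g ⊕ Fin g → ℤ) × Bool)}
    {h : Fin l.length → HandleAttachingMap 3 2 (Base g)} (hlink : IsLefschetzLink g l h)
    (i : Fin l.length) (θ : sphere (0 : EuclideanSpace ℝ (Fin 2)) 1) :
    w g ((h i).toFun (coreTubePt θ)).1 = pageDir l.length i / 2 :=
  (hlink.mem_page i θ).2

/-- **A binding point of the cap lies on no attaching circle** of a Lefschetz link (the circles lie
in pages, where `‖w‖ = 1/2`). [folklore] -/
theorem mem_coresComplement_of_w_eq_zero {g : ℕ} {l : List ((Fin g ⊕ Fin g → ℤ) × Bool)}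
    {h : Fin l.length → HandleAttachingMap 3 2 (Base g)} (hlink : IsLefschetzLink g l h)
    {a : Base g} (ha : w g a.1 = 0) : a ∈ coresComplement h := by
  rw [mem_coresComplement]
  intro i hi
  rw [← range_attachingCircle] at hi
  obtain ⟨θ, rfl⟩ := hi
  have h1 : w g ((h i).attachingCircle θ).1 = pageDir l.length i / 2 := (hlink.mem_page i θ).2
  rw [ha] at h1
  have h2 := congrArg (fun z : ℂ => ‖z‖) h1
  simp only [norm_zero, norm_div, norm_pageDir] at h2
  norm_num at h2

/-- **Binding points have shallow tube preimages, one handle**: for a continuous `f : T → ℂ` equal to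
`e`, `‖e‖ = 1/2`, on the attaching circle there is `δ > 0` with `‖t_λ‖² ≤ 1 − δ` whenever `f t = 0`.
[folklore] -/
theorem exists_lamSq_le_of_eq_zero {f : ↥(handleTube 3 2) → ℂ} (hf : Continuous f) {e : ℂ}
    (he : ∀ θ, f (coreTubePt θ) = e) (hen : ‖e‖ = 1 / 2) :
    ∃ δ : ℝ, 0 < δ ∧ ∀ t : ↥(handleTube 3 2), f t = 0 →
      lamSq 2 (((t : closedBall (0 : EuclideanSpace ℝ (Fin 4)) 1) : EuclideanSpace ℝ (Fin 4))) ≤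
        1 - δ := by
  obtain ⟨δ, hδ, hclose⟩ := BeltPageClause.exists_lamSq_gt hf he (by norm_num : (0 : ℝ) < 1 / 4)
  refine ⟨δ, hδ, fun t ht => ?_⟩
  by_contra hlt
  rw [not_le] at hlt
  have h1 := hclose t hlt
  rw [ht, zero_sub, norm_neg, hen] at h1
  norm_num at h1

/-- **Binding points have shallow tube preimages** (`κ₀` depends on the link only): there is
`κ₀ > 0` such that every tube point `t` of every handle of the Lefschetz link with `w (h̄ᵢ t) = 0`
satisfies `‖t_λ‖² ≤ 1 − 3κ₀²/4`. [folklore] -/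
theorem exists_binding_shallow {g : ℕ} {l : List ((Fin g ⊕ Fin g → ℤ) × Bool)}
    {h : Fin l.length → HandleAttachingMap 3 2 (Base g)} (hlink : IsLefschetzLink g l h) :
    ∃ κ₀ : ℝ, 0 < κ₀ ∧ ∀ (i : Fin l.length) (t : ↥(handleTube 3 2)),
      w g ((h i).toFun t).1 = 0 →
      ‖lamPart ((t : closedBall (0 : EuclideanSpace ℝ (Fin 4)) 1) : EuclideanSpace ℝ (Fin 4))‖ ^ 2 ≤
        1 - 3 * κ₀ ^ 2 / 4 := by
  have hf : ∀ i : Fin l.length, Continuous fun t : ↥(handleTube 3 2) => w g ((h i).toFun t).1 :=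
    fun i => (contDiff_w g).continuous.comp (continuous_subtype_val.comp (h i).continuous)
  choose δ hδ hle using fun i : Fin l.length =>
    exists_lamSq_le_of_eq_zero (hf i) (e := pageDir l.length i / 2) (w_toFun_coreTubePt hlink i)
      (by rw [norm_div, norm_pageDir]; norm_num)
  -- a positive lower bound of the finitely many `δ i`
  obtain ⟨δ₀, hδ₀, hδ₀le⟩ : ∃ δ₀ : ℝ, 0 < δ₀ ∧ ∀ i, δ₀ ≤ δ i := by
    rcases isEmpty_or_nonempty (Fin l.length) with hE | hN
    · exact ⟨1, one_pos, fun i => (hE.false i).elim⟩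
    · obtain ⟨i₀, hi₀⟩ := Finite.exists_min δ
      exact ⟨δ i₀, hδ i₀, hi₀⟩
  refine ⟨Real.sqrt δ₀, Real.sqrt_pos.2 hδ₀, fun i t ht => ?_⟩
  rw [Real.sq_sqrt hδ₀.le, norm_lamPart_sq]
  have h1 := hle i t ht
  have h2 := hδ₀le i
  linarith

end DualBind

/-! ## §2 T3 clause (iii) from the seam clause -/

/-- **T3 clause (iii), BIND** (hypothesis `Hbind` of X2's `T3_of_pieces`, text of `HbindStatement`
verbatim): for `κ ≤ κ₀` (the shallowness constant of §1), every `X₁`-unsurgered seam point over a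
binding point of the cap is `W₂`-unsurgered — the seam clause `hseam` applies because a binding point
is off all attaching circles, is a boundary point of the cap with `D.jA a = bX.incl z`, and has shallow
suffix-tube preimages. [cite: GompfStipsicz1999, §8.2] -/
theorem T3_bind :

  ∀ (g : ℕ) (P N : List ((Fin g ⊕ Fin g → ℤ) × Bool))
    (h : Fin (P ++ N).length → HandleAttachingMap 3 2 (Base g)) (hlink : IsLefschetzLink g (P ++ N) h),
    ∃ κ₀ : ℝ, 0 < κ₀ ∧
    ∀ {X : Type} [TopologicalSpace X] [T2Space X] [SecondCountableTopology X] [CompactSpace X]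
      [ChartedSpace (EuclideanHalfSpace 4) X] [IsManifold (𝓡∂ 4) ∞ X]
      (D : MultiAttachmentData h (𝓡∂ 4) X) (bX : BoundaryData (𝓡∂ 4) X (𝓡 3))
      (Ψ : bX.carrier ≃ₘ⟮𝓡 3, 𝓡 3⟯ (bBase g).carrier)
      (hpage : ∀ (y : bX.carrier) (a : ↥(coresComplement h)), bX.incl y = D.jA a →
        ∃ c : ℝ, 0 < c ∧ w g ((bBase g).incl (Ψ y)).1 = (c : ℂ) * w g (a : Base g).1)
      {X₁ : Type} [TopologicalSpace X₁] [T2Space X₁] [SecondCountableTopology X₁] [CompactSpace X₁]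
      [ChartedSpace (EuclideanHalfSpace 4) X₁] [IsManifold (𝓡∂ 4) ∞ X₁]
      (D₁ : MultiAttachmentData
        (fun i : Fin P.length => h (Fin.cast List.length_append.symm (Fin.castAdd N.length i))) (𝓡∂ 4) X₁)
      {W₂ : Type} [TopologicalSpace W₂] [T2Space W₂] [SecondCountableTopology W₂] [CompactSpace W₂]
      [ChartedSpace (EuclideanHalfSpace 4) W₂] [IsManifold (𝓡∂ 4) ∞ W₂]
      (b₂ : BoundaryData (𝓡∂ 4) W₂ (𝓡 3))
      (φ : (BoundaryManifold.boundaryData 3 X₁).carrier ≃ₘ⟮𝓡 3, 𝓡 3⟯ b₂.carrier)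
      (col : (BoundaryManifold.boundaryData 3 (Base g)).Collar) (κ δ : ℝ) (hκ : 0 < κ) (hκ1 : κ ≤ 1)
      (hδ : 0 < δ) (hδ2 : δ ≤ 1 / 2) (hκ0 : κ ≤ κ₀)
      (D₂ : MultiAttachmentData
        (fun j : Fin N.length => dualMap D bX (bBase g) Ψ col κ δ hκ hκ1 hδ hδ2
          (Fin.cast List.length_append.symm (Fin.natAdd P.length j))) (𝓡∂ 4) W₂)
      (hseam : ∀ (y : (BoundaryManifold.boundaryData 3 X₁).carrier) (a : ↥(coresComplement h))
        (ha₁ : (a : Base g) ∈ coresComplement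
          (fun i : Fin P.length => h (Fin.cast List.length_append.symm (Fin.castAdd N.length i))))
        (z : bX.carrier) (hz : D.jA a = bX.incl z),
        (BoundaryManifold.boundaryData 3 X₁).incl y = D₁.jA ⟨a, ha₁⟩ →
        (∀ (j : Fin N.length) (t : ↥(handleTube 3 2)),
          (h (Fin.cast List.length_append.symm (Fin.natAdd P.length j))).toFun t = (a : Base g) →
          ‖lamPart ((t : closedBall (0 : EuclideanSpace ℝ (Fin 4)) 1) : EuclideanSpace ℝ (Fin 4))‖ ^ 2 ≤
            1 - 3 * κ ^ 2 / 4) →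
        b₂.incl (φ y) = D₂.jA ⟨(bBase g).incl (Ψ z), incl_mem_coresComplement_dualMap D bX (bBase g) Ψ col κ δ
          hκ hκ1 hδ hδ2 (fun j : Fin N.length => Fin.cast List.length_append.symm (Fin.natAdd P.length j))
          z a hz⟩),
      ∀ (y : (BoundaryManifold.boundaryData 3 X₁).carrier)
        (a : ↥(coresComplement
          (fun i : Fin P.length => h (Fin.cast List.length_append.symm (Fin.castAdd N.length i))))),
        (BoundaryManifold.boundaryData 3 X₁).incl y = D₁.jA a → w g (a : Base g).1 = 0 →
        ∃ a' : ↥(coresComplement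
          (fun j : Fin N.length => dualMap D bX (bBase g) Ψ col κ δ hκ hκ1 hδ hδ2
            (Fin.cast List.length_append.symm (Fin.natAdd P.length j)))),
          b₂.incl (φ y) = D₂.jA a' := by
  intro g P N h hlink
  obtain ⟨κ₀, hκ₀, hsh⟩ := DualBind.exists_binding_shallow hlink
  refine ⟨κ₀, hκ₀, ?_⟩
  intro X _ _ _ _ _ _ D bX Ψ _ X₁ _ _ _ _ _ _ D₁ W₂ _ _ _ _ _ _ b₂ φ col κ δ hκ hκ1 hδ hδ2 hκ0 D₂ hseam
    y a hy hw
  -- the binding point lifts to `Base g ∖ ⋃ cores` (all handles)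
  have hmem : (a : Base g) ∈ coresComplement h := DualBind.mem_coresComplement_of_w_eq_zero hlink hw
  set aAll : ↥(coresComplement h) := ⟨(a : Base g), hmem⟩ with haAll
  -- it is a boundary point of the cap, hence an old-seam point `D.jA aAll = bX.incl z`
  have hbd₁ : D₁.jA a ∈ (𝓡∂ 4).boundary X₁ := by rw [← hy]; exact y.2
  have hbdB : (a : Base g) ∈ (𝓡∂ 4).boundary (Base g) := by
    rw [mem_boundary_iff_of_isSmoothEmbedding D₁.hjA D₁.hjAo] at hbd₁
    exact (mem_boundary_opens_iff _ a).1 hbd₁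
  have hbdX : D.jA aAll ∈ range bX.incl := by
    rw [bX.range_incl, mem_boundary_iff_of_isSmoothEmbedding D.hjA D.hjAo]
    exact (mem_boundary_opens_iff _ aAll).2 hbdB
  obtain ⟨z, hz⟩ := hbdX
  -- the suffix-tube preimages of a binding point are shallow
  have hshallow : ∀ (j : Fin N.length) (t : ↥(handleTube 3 2)),
      (h (Fin.cast List.length_append.symm (Fin.natAdd P.length j))).toFun t = (aAll : Base g) →
      ‖lamPart ((t : closedBall (0 : EuclideanSpace ℝ (Fin 4)) 1) : EuclideanSpace ℝ (Fin 4))‖ ^ 2 ≤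
        1 - 3 * κ ^ 2 / 4 := by
    intro j t ht
    have h1 := hsh (Fin.cast List.length_append.symm (Fin.natAdd P.length j)) t (by rw [ht]; exact hw)
    have h2 : κ ^ 2 ≤ κ₀ ^ 2 := pow_le_pow_left₀ hκ.le hκ0 2
    linarith
  exact ⟨_, hseam y aAll a.2 z hz.symm hy hshallow⟩

/-! ## §3 The registered sub-goal -/

/-- **Registered sub-goal `helper_binding_shallow`** of `stub_T3_dualPresentation` (T3 clause (iii),
BIND, input; wave 5, lead c5): binding points of the cap have shallow preimages in the tubes of a
Lefschetz link — there is `κ₀ > 0` with `‖t_λ‖² ≤ 1 − 3κ₀²/4` for every tube point `t` of every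
handle with `w (h̄ᵢ t) = 0`. [folklore] -/
theorem helper_binding_shallow : ∀ (g : ℕ) (l : List ((Fin g ⊕ Fin g → ℤ) × Bool)) (h : Fin l.length → Literature.Topology.FourManifolds.HandleAttachingMap 3 2 (Literature.Topology.FourManifolds.LefschetzBase.Base g)), Literature.Topology.FourManifolds.LefschetzBase.IsLefschetzLink g l h → ∃ κ₀ : ℝ, 0 < κ₀ ∧ ∀ (i : Fin l.length) (t : ↥(Literature.Topology.FourManifolds.handleTube 3 2)), Literature.Topology.FourManifolds.LefschetzBase.w g ((h i).toFun t).1 = 0 → ‖Literature.Topology.FourManifolds.lamPart ((t : Metric.closedBall (0 : EuclideanSpace ℝ (Fin 4)) 1) : EuclideanSpace ℝ (Fin 4))‖ ^ 2 ≤ 1 - 3 * κ₀ ^ 2 / 4 :=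
  fun _ _ _ hlink => DualBind.exists_binding_shallow hlink

end Summit.SmoothPoincare4.SmoothPoincare4.Theorems.AcyclicBisectionExists.ModpBraidOrbits
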